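import Summits.BirchSwinnertonDyer.BirchSwinnertonDyer.Theorems.KatoDescentPotSupersingularWildConjAResidueUnitIndexRows03
import Literature.NumberTheory.IwasawaTheory.Fukuda1994Thm1RankProofs
import Literature.NumberTheory.IwasawaTheory.Fukuda1994Thm1Proofs
import HarnessLib

/-!
# K9 records of `WildConjAResidueUnitIndexRows03` with Fukuda's Theorem 1 (2) DISCHARGED (hF2-free re-issue)

Written by the prover seat `bsd-potss-k8t-c4` g20 (cell `bsd-potss`; courtesy for the K9 record lane of k9-c4,
`--supports stmt-BirchSwinnertonDyer-19197 --as helper`; closes nothing; BSD claimed for no curve). Every record of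
`Theorems/KatoDescentPotSupersingularWildConjAResidueUnitIndexRows03.lean` that displayed the named-fact hypothesis `hF2 : fukuda1994_thm1_classGroupPRank_const_of_succ_eq`
(Fukuda 1994 Thm. 1 (2), `p`-ranks) is re-issued WITHOUT it (suffix `F2`, one application of the tree theorem
`Literature.NumberTheory.IwasawaTheory.fukuda1994_thm1_classGroupPRank_const_of_succ_eq_holds`, `Fukuda1994Thm1RankProofs.lean`, k8t-c4 g20;
where a record also displayed `hF1`, Fukuda Thm. 1 (1), it is discharged too by g19's `fukuda1994_thm1_classNumberPExp_const_of_succ_eq_holds`).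
All other displayed named facts (`hCS`, `hI`, `hFW`, `hKatoA`, `hGZK`, `hmod`, …) and row data (`hWeq`, `hr`, `c`, `hrk`/`hord`) are untouched;
statements are those of the source records verbatim minus the Fukuda binders.
-/

set_option autoImplicit false
set_option linter.dupNamespace false

noncomputable section

open scoped Classical NumberField
open WeierstrassCurve NumberField IsDedekindDomain Field IntermediateField
  Literature.NumberTheory.EllipticCurves Literature.NumberTheory.EllipticCurves.Rank1Residual
  Literature.NumberTheory.EllipticCurves.Rank1Residual.Typed
  Literature.NumberTheory.GaloisRepresentations Literature.NumberTheory.SerreUniformity Literature.NumberTheory.IwasawaTheory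
  Summit.BirchSwinnertonDyer.Rank1Residual Summit.BirchSwinnertonDyer.Rank1Residual.Additive
  Summit.BirchSwinnertonDyer.BirchSwinnertonDyer.Theorems
namespace Summit.BirchSwinnertonDyer.BirchSwinnertonDyer.Theorems.WildUpperUnitTwistRecords

/-- **(A) AT `(261360he1, 3)` with `hμ` DISCHARGED by FUKUDA Thm. 1 (2) (`3`-RANKS) at layers `(1,2)` (`rank₁ = rank₂`)** (modulo `hCS`, `hFW`, `hF2`): `c` a complex conjugation, `Kp = ℚ(E[3])^c`
(`hKp`; `K⁺ = ℚ[x]/(x⁴ + 22x² − 11)`: `h = 2, 6, 18` at layers `0, 1, 2` (CERT, CERT, GRH), `e = 0, 1, 2` but `3`-rank `0, 1, 1`), displayed numerics: Fukuda index `0` (`hram`, exact) and `hrk` (layer `1` certified, layer `2` under GRH; kit j308602).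
KERNEL: the `3Ns` image (g18). CONDITIONAL; nothing booked; (A)/BSD proved for no curve. [cite: Fukuda1994, Thm. 1 (2), p. 264] [cite: CoatesSujatha2005, Thm. 3.4 (§3)]
[cite: Cremona2006, Table 1 (Cremona label 261360he1)]
hF2-FREE re-issue of `conjA_g261360he1_3_fr12` (Fukuda 1994 Thm. 1 (2) is the tree theorem
`fukuda1994_thm1_classGroupPRank_const_of_succ_eq_holds`). -/
theorem conjA_g261360he1_3_fr12F2
    (hCS : CoatesSujatha2005.thm34_fineSelmerDual_moduleFinite_of_classicalMuVanishes_divisionField)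
    (hFW : ferreroWashington1979_classicalMuVanishes)
    {W : WeierstrassCurve ℚ} [W.IsElliptic] (hWeq : W = (⟨0, 0, 0, 22604373, (-9557732646)⟩ : WeierstrassCurve ℚ))
    {c : absoluteGaloisGroup ℚ} (hc : IsComplexConjugation (Rat.castHom ℝ) c)
    (Kp : IntermediateField ℚ ↥(W.divisionField 3)) (hKp : Kp = fixedField (Subgroup.zpowers (absRestrictNormalHom (W.divisionField 3) c)))
    (hram : ∀ κE : ZpExtension ↥Kp 3, κE.IsCyclotomic → TotallyRamifiedFrom κE 0)
    (hrk : ∀ κE : ZpExtension ↥Kp 3, κE.IsCyclotomic → classGroupPRank κE (1 + 1) = classGroupPRank κE 1)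
    (κ : ZpExtension ℚ 3) (hκ : κ.IsCyclotomic) :
    ∃ (γ : absoluteGaloisGroup ℚ) (Df : W.FineSelmerDualData κ γ),
      Module.Finite ℤ_[3] (RestrictScalars ℤ_[3] (IwasawaAlgebra 3) Df.X) := by
  apply conjA_g261360he1_3_fr12 <;>
    first
    | exact Literature.NumberTheory.IwasawaTheory.fukuda1994_thm1_classGroupPRank_const_of_succ_eq_holds
    | exact Literature.NumberTheory.IwasawaTheory.fukuda1994_thm1_classNumberPExp_const_of_succ_eq_holds
    | assumption

/-- **RECORD — U₀ `ord₃ #Ш(E) ≤ ord₃ #Ш_an(E)` for `E = 261360he1` with `hμ` DISCHARGED by FUKUDA Thm. 1 (2) (`3`-RANKS) at layers `(1,2)` (`rank₁ = rank₂`)**: named facts {A161-fine `hKatoA`, GZK `hGZK`,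
modularity `hmod`, `hCS`, `hFW`, `hF2`}, Cremona's `r_an = 0` (`hr`), and the displayed layer data `hram` / `hrk` of `Kp = ℚ(E[3])^c` (`K⁺ = ℚ[x]/(x⁴ + 22x² − 11)`: `h = 2, 6, 18` at layers `0, 1, 2` (CERT, CERT, GRH), `e = 0, 1, 2` but `3`-rank `0, 1, 1`;
kit j308602). KERNEL (g18): elliptic, minimal, `ClassO6 E 3`, `E[3]` irreducible, `3Ns` image. Supersedes the displayed-`hμ` record
`missingUpperBoundAt_g261360he1_3`. Per row; nothing booked; BSD proved for no curve. [cite: Kato2004Asterisque, Thm. 14.5 (3) (p. 236)] [cite: Fukuda1994, Thm. 1 (2), p. 264]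
[cite: Cremona2006, Table 1 (Cremona label 261360he1)]
hF2-FREE re-issue of `missingUpperBoundAt_g261360he1_3_fr12` (Fukuda 1994 Thm. 1 (2) is the tree theorem
`fukuda1994_thm1_classGroupPRank_const_of_succ_eq_holds`). -/
theorem missingUpperBoundAt_g261360he1_3_fr12F2
    (hKatoA : Kato2004.rankZero_padicValNat_sha_add_padicValNat_tamagawa_le_of_additive_potGood_of_irreducible_of_fineSelmerDual_fg)
    (hGZK : rank_eq_analyticRank_of_analyticRank_le_one) (hmod : hasEntireLFunction_rat)
    (hCS : CoatesSujatha2005.thm34_fineSelmerDual_moduleFinite_of_classicalMuVanishes_divisionField)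
    (hFW : ferreroWashington1979_classicalMuVanishes)
    {W : WeierstrassCurve ℚ} [W.IsElliptic] [W.IsGloballyMinimal] (hWeq : W = (⟨0, 0, 0, 22604373, (-9557732646)⟩ : WeierstrassCurve ℚ)) (hr : W.analyticRank = 0)
    {c : absoluteGaloisGroup ℚ} (hc : IsComplexConjugation (Rat.castHom ℝ) c)
    (Kp : IntermediateField ℚ ↥(W.divisionField 3)) (hKp : Kp = fixedField (Subgroup.zpowers (absRestrictNormalHom (W.divisionField 3) c)))
    (hram : ∀ κE : ZpExtension ↥Kp 3, κE.IsCyclotomic → TotallyRamifiedFrom κE 0)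
    (hrk : ∀ κE : ZpExtension ↥Kp 3, κE.IsCyclotomic → classGroupPRank κE (1 + 1) = classGroupPRank κE 1) :
    MissingUpperBoundAt W 3 := by
  apply missingUpperBoundAt_g261360he1_3_fr12 <;>
    first
    | exact Literature.NumberTheory.IwasawaTheory.fukuda1994_thm1_classGroupPRank_const_of_succ_eq_holds
    | exact Literature.NumberTheory.IwasawaTheory.fukuda1994_thm1_classNumberPExp_const_of_succ_eq_holds
    | assumption

/-- **(A) AT `(261360iv1, 3)` with `hμ` DISCHARGED by FUKUDA Thm. 1 (2) (`3`-RANKS) at layers `(1,2)` (`rank₁ = rank₂`)** (modulo `hCS`, `hFW`, `hF2`): `c` a complex conjugation, `Kp = ℚ(E[3])^c`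
(`hKp`; `K⁺ = ℚ[x]/(x⁴ + 22x² − 11)`: `h = 2, 6, 18` at layers `0, 1, 2` (CERT, CERT, GRH), `e = 0, 1, 2` but `3`-rank `0, 1, 1`), displayed numerics: Fukuda index `0` (`hram`, exact) and `hrk` (layer `1` certified, layer `2` under GRH; kit j308602).
KERNEL: the `3Ns` image (g18). CONDITIONAL; nothing booked; (A)/BSD proved for no curve. [cite: Fukuda1994, Thm. 1 (2), p. 264] [cite: CoatesSujatha2005, Thm. 3.4 (§3)]
[cite: Cremona2006, Table 1 (Cremona label 261360iv1)]
hF2-FREE re-issue of `conjA_g261360iv1_3_fr12` (Fukuda 1994 Thm. 1 (2) is the tree theorem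
`fukuda1994_thm1_classGroupPRank_const_of_succ_eq_holds`). -/
theorem conjA_g261360iv1_3_fr12F2
    (hCS : CoatesSujatha2005.thm34_fineSelmerDual_moduleFinite_of_classicalMuVanishes_divisionField)
    (hFW : ferreroWashington1979_classicalMuVanishes)
    {W : WeierstrassCurve ℚ} [W.IsElliptic] (hWeq : W = (⟨0, 0, 0, (-1832787), (-687043566)⟩ : WeierstrassCurve ℚ))
    {c : absoluteGaloisGroup ℚ} (hc : IsComplexConjugation (Rat.castHom ℝ) c)
    (Kp : IntermediateField ℚ ↥(W.divisionField 3)) (hKp : Kp = fixedField (Subgroup.zpowers (absRestrictNormalHom (W.divisionField 3) c)))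
    (hram : ∀ κE : ZpExtension ↥Kp 3, κE.IsCyclotomic → TotallyRamifiedFrom κE 0)
    (hrk : ∀ κE : ZpExtension ↥Kp 3, κE.IsCyclotomic → classGroupPRank κE (1 + 1) = classGroupPRank κE 1)
    (κ : ZpExtension ℚ 3) (hκ : κ.IsCyclotomic) :
    ∃ (γ : absoluteGaloisGroup ℚ) (Df : W.FineSelmerDualData κ γ),
      Module.Finite ℤ_[3] (RestrictScalars ℤ_[3] (IwasawaAlgebra 3) Df.X) := by
  apply conjA_g261360iv1_3_fr12 <;>
    first
    | exact Literature.NumberTheory.IwasawaTheory.fukuda1994_thm1_classGroupPRank_const_of_succ_eq_holds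
    | exact Literature.NumberTheory.IwasawaTheory.fukuda1994_thm1_classNumberPExp_const_of_succ_eq_holds
    | assumption

/-- **RECORD — U₀ `ord₃ #Ш(E) ≤ ord₃ #Ш_an(E)` for `E = 261360iv1` with `hμ` DISCHARGED by FUKUDA Thm. 1 (2) (`3`-RANKS) at layers `(1,2)` (`rank₁ = rank₂`)**: named facts {A161-fine `hKatoA`, GZK `hGZK`,
modularity `hmod`, `hCS`, `hFW`, `hF2`}, Cremona's `r_an = 0` (`hr`), and the displayed layer data `hram` / `hrk` of `Kp = ℚ(E[3])^c` (`K⁺ = ℚ[x]/(x⁴ + 22x² − 11)`: `h = 2, 6, 18` at layers `0, 1, 2` (CERT, CERT, GRH), `e = 0, 1, 2` but `3`-rank `0, 1, 1`;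
kit j308602). KERNEL (g18): elliptic, minimal, `ClassO6 E 3`, `E[3]` irreducible, `3Ns` image. Supersedes the displayed-`hμ` record
`missingUpperBoundAt_g261360iv1_3`. Per row; nothing booked; BSD proved for no curve. [cite: Kato2004Asterisque, Thm. 14.5 (3) (p. 236)] [cite: Fukuda1994, Thm. 1 (2), p. 264]
[cite: Cremona2006, Table 1 (Cremona label 261360iv1)]
hF2-FREE re-issue of `missingUpperBoundAt_g261360iv1_3_fr12` (Fukuda 1994 Thm. 1 (2) is the tree theorem
`fukuda1994_thm1_classGroupPRank_const_of_succ_eq_holds`). -/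
theorem missingUpperBoundAt_g261360iv1_3_fr12F2
    (hKatoA : Kato2004.rankZero_padicValNat_sha_add_padicValNat_tamagawa_le_of_additive_potGood_of_irreducible_of_fineSelmerDual_fg)
    (hGZK : rank_eq_analyticRank_of_analyticRank_le_one) (hmod : hasEntireLFunction_rat)
    (hCS : CoatesSujatha2005.thm34_fineSelmerDual_moduleFinite_of_classicalMuVanishes_divisionField)
    (hFW : ferreroWashington1979_classicalMuVanishes)
    {W : WeierstrassCurve ℚ} [W.IsElliptic] [W.IsGloballyMinimal] (hWeq : W = (⟨0, 0, 0, (-1832787), (-687043566)⟩ : WeierstrassCurve ℚ)) (hr : W.analyticRank = 0)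
    {c : absoluteGaloisGroup ℚ} (hc : IsComplexConjugation (Rat.castHom ℝ) c)
    (Kp : IntermediateField ℚ ↥(W.divisionField 3)) (hKp : Kp = fixedField (Subgroup.zpowers (absRestrictNormalHom (W.divisionField 3) c)))
    (hram : ∀ κE : ZpExtension ↥Kp 3, κE.IsCyclotomic → TotallyRamifiedFrom κE 0)
    (hrk : ∀ κE : ZpExtension ↥Kp 3, κE.IsCyclotomic → classGroupPRank κE (1 + 1) = classGroupPRank κE 1) :
    MissingUpperBoundAt W 3 := by
  apply missingUpperBoundAt_g261360iv1_3_fr12 <;>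
    first
    | exact Literature.NumberTheory.IwasawaTheory.fukuda1994_thm1_classGroupPRank_const_of_succ_eq_holds
    | exact Literature.NumberTheory.IwasawaTheory.fukuda1994_thm1_classNumberPExp_const_of_succ_eq_holds
    | assumption

end Summit.BirchSwinnertonDyer.BirchSwinnertonDyer.Theorems.WildUpperUnitTwistRecords

end
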